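import Literature.NumberTheory.PAdicHodge.BlochKatoDualExponential
import Literature.NumberTheory.EllipticCurves.CyclotomicZpExtension
import Literature.IUT.LogVolume.LogSeriesEstimates
import HarnessLib

/-!
# `log χ_cyclo` is a `ℤ_p`-multiple of the cyclotomic character of the `ℤ_p`-extension:
# `log_p u = ℓ(u) · log_p(γ_cyc)` on `ℤ_pˣ`

Topic `Literature/NumberTheory/PAdicHodge`; THEOREMS ONLY (no definition, no named fact, no instance, no `sorry`).
The tree has two normalisations of "the logarithm of the cyclotomic character":
* Kato's `log(χ_cyclo) : Γ_F → ℚ_p` (LNM 1553, II 1.2.2) = `PAdicHodge.logCyclotomic p σ := log_p(χ_p(σ))` with Neukirch's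
  `log_p = IUT.LogVolume.unitLog` on `ℤ_pˣ` (`BlochKatoDualExponential.lean`);
* the NORMALISED logarithm `ℓ = CyclotomicZp.ell p : ℤ_pˣ → ℤ_p` (`ℓ(γ_cyc) = 1`, `γ_cyc = 1 + p^{e₀}`, `ker ℓ = μ(ℤ_p)`), built
  in `CyclotomicZpExtension.lean` from the exponential `x ↦ γ_cyc^x` (`cycPow`) WITHOUT `log_p`, of which the cyclotomic
  `ℤ_p`-extension of `ℚ` is `κ_cyc = ℓ ∘ χ_p` (`CyclotomicZp.zpExtension`).

This file proves they differ by the constant `log_p(γ_cyc)`: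
* `unitLog_coe_cycPow` — `log_p(γ_cyc^x) = x · log_p(γ_cyc)` for all `x ∈ ℤ_p` (additivity + continuity at `0` via the Lipschitz
  bound `‖L(y)‖ ≤ ‖1 − y‖` of `LogSeriesEstimates`, then density of `ℕ` in `ℤ_p`);
* ★ `unitLog_coe_units_eq_ell_mul` — **`log_p(u) = ℓ(u) · log_p(γ_cyc)`** for `u ∈ ℤ_pˣ` (`γ_cyc^{t ℓ(u)} = u^t`, `t = #μ(ℤ_p)`);
* ★ `logCyclotomic_eq_ell_mul` — `log χ_cyclo(σ) = ℓ(χ_p(σ)) · log_p(γ_cyc)` for every `p`-adic field `F` and `σ ∈ Γ_F`;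
* `norm_unitLog_cyclotomicGenerator_le` — `‖log_p(γ_cyc)‖ ≤ p^{-e₀} < 1` (so the constant lies in `pℤ_p`).

Use: the calibration of Kato's reciprocity law in `ℤ_p`-coefficients (`GaloisCohomology.invPadic_cupProduct_kummerPadic_eq_neg_mul_
of_isCyclotomic`, `ψ = a · (κ ∘ res)`) with `ψ = log χ_cyclo`, `a = log_p(γ_cyc)`, `κ = κ_cyc` (line `kato_lever` of crux K★
stmt-BirchSwinnertonDyer-22226). BSD is not proved by any of this.

## References
* K. Kato, LNM 1553 (1993), Ch. II 1.2.2, Lemma 1.4.5. [Kato1993LNM1553]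
* J. Neukirch, *Algebraic Number Theory* (1999), Ch. II (5.4)–(5.5) (`log_p`). [NeukirchANT1999]
* J.-P. Serre, *A Course in Arithmetic* (1973), Ch. II §3.2 Prop. 8 (`ℤ_pˣ = μ × (1 + p^{e₀}ℤ_p) ≅ μ × ℤ_p`). [Serre1973]
-/

noncomputable section

open Filter Topology Field

namespace Literature.NumberTheory.PAdicHodge

open Literature.IUT.LogVolume
open Literature.NumberTheory.EllipticCurves
open Literature.NumberTheory.EllipticCurves.CyclotomicZp
open Literature.NumberTheory.EllipticCurves.PadicOneUnits
open Literature.NumberTheory.GaloisRepresentations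

variable (p : ℕ) [hp : Fact p.Prime]

/-! ### `log_p` on the one-parameter group `x ↦ γ_cyc^x` -/

/-- `‖γ_cyc^x‖ = 1` in `ℚ_p`. [folklore] -/
private theorem norm_coe_cycPow (x : ℤ_[p]) : ‖((cycPow p x : ℤ_[p]) : ℚ_[p])‖ = 1 := by
  rw [← PadicInt.norm_def]; exact norm_cycPow p x

/-- `‖1 − γ_cyc^x‖ = ‖x‖ · ‖p^{e₀}‖ ≤ ‖x‖` in `ℚ_p`. [cite: Serre1973, Ch. II §3.2 Prop. 8] -/
theorem norm_one_sub_coe_cycPow (x : ℤ_[p]) :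
    ‖(1 : ℚ_[p]) - ((cycPow p x : ℤ_[p]) : ℚ_[p])‖ = ‖x‖ * ‖((p : ℤ_[p]) ^ cyclotomicExponent p)‖ := by
  rw [← norm_neg, neg_sub, ← PadicInt.coe_one, ← PadicInt.coe_sub, ← PadicInt.norm_def, cycPow,
    norm_oneAddPow_sub_one _ (cyclotomicExponent_cond p), ← cyclotomicExponent_eq_succ]

/-- `‖p^{e₀}‖ ≤ p⁻¹` (`e₀ ≥ 1`). [folklore] -/
private theorem norm_p_pow_cyclotomicExponent_le : ‖((p : ℤ_[p]) ^ cyclotomicExponent p)‖ ≤ (p : ℝ)⁻¹ := by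
  rw [PadicInt.norm_p_pow, ← zpow_neg_one]
  have h := cyclotomicExponent_eq_succ p
  exact zpow_le_zpow_right₀ (by exact_mod_cast hp.out.one_lt.le) (by omega)

/-- The Lipschitz constant condition of `LogSeriesEstimates` at `ρ = p⁻¹`: `p⁻¹ · p^{1/(p−1)} ≤ 1`. [cite: Koblitz1984, Ch. IV §1] -/
private theorem inv_mul_rpow_le_one : (p : ℝ)⁻¹ * (p : ℝ) ^ (1 / ((p : ℝ) - 1)) ≤ 1 := by
  have hp1 : (1 : ℝ) ≤ p := by exact_mod_cast hp.out.one_lt.le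
  have hp2 : (2 : ℝ) ≤ p := by exact_mod_cast hp.out.two_le
  have h : (p : ℝ) ^ (1 / ((p : ℝ) - 1)) ≤ (p : ℝ) ^ (1 : ℝ) :=
    Real.rpow_le_rpow_of_exponent_le hp1 (by rw [div_le_one (by linarith)]; linarith)
  rw [Real.rpow_one] at h
  calc (p : ℝ)⁻¹ * (p : ℝ) ^ (1 / ((p : ℝ) - 1)) ≤ (p : ℝ)⁻¹ * p := by gcongr
    _ = 1 := inv_mul_cancel₀ (by positivity)

/-- **`‖log_p(γ_cyc^x)‖ ≤ ‖x‖`** (Lipschitz bound of the logarithmic series on `1 + p^{e₀}ℤ_p`). [cite: Koblitz1984, Ch. IV §1] -/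
theorem norm_unitLog_coe_cycPow_le (x : ℤ_[p]) : ‖unitLog ((cycPow p x : ℤ_[p]) : ℚ_[p])‖ ≤ ‖x‖ := by
  have h1 := norm_one_sub_coe_cycPow p x
  have hle : ‖(1 : ℚ_[p]) - ((cycPow p x : ℤ_[p]) : ℚ_[p])‖ ≤ ‖x‖ := by
    rw [h1]; exact mul_le_of_le_one_right (norm_nonneg _) (PadicInt.norm_le_one _)
  have hρ : ‖(1 : ℚ_[p]) - ((cycPow p x : ℤ_[p]) : ℚ_[p])‖ ≤ (p : ℝ)⁻¹ := by
    rw [h1]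
    exact (mul_le_of_le_one_left (norm_nonneg _) (PadicInt.norm_le_one _)).trans (norm_p_pow_cyclotomicExponent_le p)
  have hprin : IsPrincipal ((cycPow p x : ℤ_[p]) : ℚ_[p]) :=
    hρ.trans_lt (inv_lt_one_of_one_lt₀ (by exact_mod_cast hp.out.one_lt))
  rw [unitLog_of_isPrincipal (p := p) hprin]
  exact (norm_logSeries_le_norm p ℚ_[p] (inv_mul_rpow_le_one p) hρ).trans hle

/-- `x ↦ log_p(γ_cyc^x)` is additive (`γ_cyc^{x+y} = γ_cyc^x γ_cyc^y`, `log_p` of a product of units).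
[cite: NeukirchANT1999, Ch. II (5.5)] -/
theorem unitLog_coe_cycPow_add (x y : ℤ_[p]) :
    unitLog ((cycPow p (x + y) : ℤ_[p]) : ℚ_[p]) =
      unitLog ((cycPow p x : ℤ_[p]) : ℚ_[p]) + unitLog ((cycPow p y : ℤ_[p]) : ℚ_[p]) := by
  simp only [AddChar.map_add_eq_mul, PadicInt.coe_mul]
  exact unitLog_mul p (norm_coe_cycPow p x) (norm_coe_cycPow p y)

/-- `x ↦ log_p(γ_cyc^x)` is continuous (additive and Lipschitz at `0`). [cite: Koblitz1984, Ch. IV §1] -/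
theorem continuous_unitLog_coe_cycPow : Continuous fun x : ℤ_[p] => unitLog ((cycPow p x : ℤ_[p]) : ℚ_[p]) := by
  let f : ℤ_[p] →+ ℚ_[p] := AddMonoidHom.mk' (fun x => unitLog ((cycPow p x : ℤ_[p]) : ℚ_[p])) (unitLog_coe_cycPow_add p)
  change Continuous f
  refine continuous_of_continuousAt_zero f ?_
  rw [ContinuousAt, map_zero, Metric.tendsto_nhds]
  intro ε hε
  filter_upwards [Metric.ball_mem_nhds (0 : ℤ_[p]) hε] with x hx
  rw [dist_zero_right]
  rw [Metric.mem_ball, dist_zero_right] at hx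
  exact (norm_unitLog_coe_cycPow_le p x).trans_lt hx

/-- **`log_p(γ_cyc^x) = x · log_p(γ_cyc)` for every `x ∈ ℤ_p`** (true for `x ∈ ℕ` by additivity; both sides are continuous and `ℕ` is
dense in `ℤ_p`). [cite: NeukirchANT1999, Ch. II (5.5)] [cite: Serre1973, Ch. II §3.2 Prop. 8] -/
theorem unitLog_coe_cycPow (x : ℤ_[p]) :
    unitLog ((cycPow p x : ℤ_[p]) : ℚ_[p]) = (x : ℚ_[p]) * unitLog ((cyclotomicGenerator p : ℤ_[p]) : ℚ_[p]) := by
  have hnat : ∀ n : ℕ, unitLog ((cycPow p n : ℤ_[p]) : ℚ_[p]) =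
      (n : ℚ_[p]) * unitLog ((cyclotomicGenerator p : ℤ_[p]) : ℚ_[p]) := fun n => by
    induction n with
    | zero => rw [Nat.cast_zero, AddChar.map_zero_eq_one, PadicInt.coe_one, unitLog_one (p := p), Nat.cast_zero, zero_mul]
    | succ n ih => rw [Nat.cast_succ, unitLog_coe_cycPow_add, ih, cycPow_one, Nat.cast_succ, add_mul, one_mul]
  have h := Continuous.ext_on PadicInt.denseRange_natCast (continuous_unitLog_coe_cycPow p)
    (g := fun y : ℤ_[p] => (y : ℚ_[p]) * unitLog ((cyclotomicGenerator p : ℤ_[p]) : ℚ_[p]))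
    (continuous_subtype_val.mul continuous_const) ?_
  · exact congrFun h x
  · rintro _ ⟨n, rfl⟩
    simp only [hnat n, PadicInt.coe_natCast]

/-! ### `log_p = log_p(γ_cyc) · ℓ` on `ℤ_pˣ` -/

/-- ★ **`log_p(u) = ℓ(u) · log_p(γ_cyc)` for `u ∈ ℤ_pˣ`**: Neukirch's `p`-adic logarithm on the units of `ℤ_p` is the normalised logarithm
`ℓ` (`ℓ(γ_cyc) = 1`, `ker ℓ = μ(ℤ_p)`) times the constant `log_p(γ_cyc) = log_p(1 + p^{e₀})` (from `γ_cyc^{t ℓ(u)} = u^t`, `t = #μ(ℤ_p)`,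
and `unitLog_coe_cycPow`; characteristic `0`). [cite: Serre1973, Ch. II §3.2 Prop. 8] [cite: NeukirchANT1999, Ch. II (5.5)] -/
theorem unitLog_coe_units_eq_ell_mul (u : ℤ_[p]ˣ) :
    unitLog (((u : ℤ_[p]) : ℚ_[p])) = (ell p u : ℚ_[p]) * unitLog ((cyclotomicGenerator p : ℤ_[p]) : ℚ_[p]) := by
  have ht : (torsionOrder p : ℚ_[p]) ≠ 0 :=
    Nat.cast_ne_zero.mpr (Nat.totient_pos.mpr (pow_pos hp.out.pos _)).ne'
  have hu : ‖((u : ℤ_[p]) : ℚ_[p])‖ = 1 := by rw [← PadicInt.norm_def]; exact PadicInt.isUnit_iff.mp u.isUnit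
  apply mul_left_cancel₀ ht
  rw [← unitLog_pow p hu, ← PadicInt.coe_pow, ← cycPow_torsionOrder_mul_ell, unitLog_coe_cycPow, PadicInt.coe_mul,
    PadicInt.coe_natCast, mul_assoc]

/-- `‖log_p(γ_cyc)‖ ≤ ‖p^{e₀}‖ < 1`: the constant lies in `p ℤ_p`. [cite: NeukirchANT1999, Ch. II (5.5)] -/
theorem norm_unitLog_cyclotomicGenerator_le :
    ‖unitLog ((cyclotomicGenerator p : ℤ_[p]) : ℚ_[p])‖ ≤ ‖((p : ℤ_[p]) ^ cyclotomicExponent p)‖ := by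
  have h := norm_unitLog_coe_cycPow_le p 1
  rw [cycPow_one, norm_one] at h
  have h1 := norm_one_sub_coe_cycPow p 1
  rw [cycPow_one, norm_one, one_mul] at h1
  have hρ : ‖(1 : ℚ_[p]) - ((cyclotomicGenerator p : ℤ_[p]) : ℚ_[p])‖ ≤ (p : ℝ)⁻¹ :=
    h1.le.trans (norm_p_pow_cyclotomicExponent_le p)
  have hprin : IsPrincipal (((cyclotomicGenerator p : ℤ_[p]) : ℚ_[p])) :=
    hρ.trans_lt (inv_lt_one_of_one_lt₀ (by exact_mod_cast hp.out.one_lt))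
  rw [unitLog_of_isPrincipal (p := p) hprin, ← h1]
  exact norm_logSeries_le_norm p ℚ_[p] (inv_mul_rpow_le_one p) hρ

/-! ### Kato's `log χ_cyclo` against the normalised logarithm -/

variable {F : Type} [Field F]

/-- ★ **`log χ_cyclo(σ) = ℓ(χ_p(σ)) · log_p(γ_cyc)`** for every field `F` and `σ ∈ Γ_F`: Kato's `log(χ_cyclo) ∈ Hom(Γ_F, ℤ_p)`
(LNM 1553, II 1.2.2) is the `ℤ_p`-multiple `log_p(γ_cyc) · (ℓ ∘ χ_p)` of the normalised cyclotomic logarithm (for `F ⊇ ℚ`,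
`ℓ ∘ χ_p = κ_cyc ∘ res`, the cyclotomic `ℤ_p`-extension `CyclotomicZp.zpExtension`).
[cite: Kato1993LNM1553, Ch. II 1.2.2] [cite: Serre1973, Ch. II §3.2 Prop. 8] -/
theorem logCyclotomic_eq_ell_mul (σ : absoluteGaloisGroup F) :
    logCyclotomic (F := F) p σ =
      (ell p (GaloisRep.cyclotomicCharacter F p σ) : ℚ_[p]) * unitLog ((cyclotomicGenerator p : ℤ_[p]) : ℚ_[p]) :=
  unitLog_coe_units_eq_ell_mul p _

end Literature.NumberTheory.PAdicHodge

end
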